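/-
Copyright (c) 2026. All rights reserved.
Released under Apache 2.0 license as described in the file LICENSE.
Authors: abc-iut cell, R-W prover seat abc-iut-W-neg-1 (gen 2).
-/
import Literature.IUT.LogVolume.DifferentLocalCriterion
import Literature.IUT.LogVolume.LocalFieldTraceRetraction
import Literature.IUT.LogVolume.FundamentalIdentity
import Mathlib.Analysis.Normed.Algebra.Basic
import Mathlib.RingTheory.Trace.Basic
import HarnessLib

/-!
# The different of a `p`-adic field containing a `p`-th root of a uniformizer of `ℚ_p` is (Ore-)maximal:
# `𝔪_K^{2e−1} ∣ 𝔇_{K/ℚ_p}`, i.e. `d_K ≥ (2e − 1)/e`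

Classical local algebra (J.-P. Serre, *Corps locaux*, Ch. III §6 Prop. 13 and Remark (Ore's bound
`v_K(𝔇) ≤ e − 1 + v_K(e)`); E. Hecke / H. Cohen, *Advanced Topics in Computational Number Theory*, GTM 193,
Thm. 10.2.9 for the prime-degree Kummer case), in the norm-side setting of the cell's [IUTchIV] §1 files
(`K` a nontrivially normed field, normed `ℚ_p`-algebra, ultrametric, proper; `e = absRamificationIdx p K`,
`d = differentOrd p K` with `ord(p) = 1`).

Let `π ∈ ℚ_p` with `‖π‖ = p⁻¹` (a uniformizer of `ℤ_p`) and suppose `K` contains `y` with `y^p = π` (an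
EISENSTEIN radical: the minimal polynomial `X^p − π` is Eisenstein). THIS FILE PROVES:

* `norm_eq_rpow_of_pow_prime_eq` — `‖y‖ = p^{−1/p}`; `prime_dvd_absRamificationIdx_of_pow_prime_eq` — `p ∣ e`.
* `norm_le_norm_sum_of_pairwise_norm_ne` — the ultrametric «distinct norms» principle: in a finite sum whose
  nonzero terms have pairwise distinct norms, every term is bounded by the sum; applied to
  `Σ_{k<p} a_k y^k` (`a_k ∈ ℚ_p`): `‖a_k y^k‖ ≤ ‖Σ_j a_j y^j‖` (`norm_smul_pow_le_norm_sum_of_pow_prime_eq`),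
  since `‖a_j y^j‖ ∈ p^{ℤ − j/p}` are pairwise distinct.
* `norm_trace_adjoin_le_of_pow_prime_eq` — on `V = ℚ_p(y)`: `Tr_{V/ℚ_p}(Σ a_k y^k) = p·a₀` (the matrix of
  multiplication by `y^k`, `0 < k < p`, in the basis `1, y, …, y^{p−1}` has zero diagonal), hence
  `‖m‖ < 1 ⇒ ‖Tr_{V/ℚ_p}(m)‖ ≤ p⁻²`.
* `norm_trace_intermediateField_le` — `‖Tr_{K/V}(m)‖ ≤ ‖m‖` for any intermediate field `V` (the conjugates
  are isometric images, campaign-S `norm_map_algHom`).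
* **`norm_trace_le_of_pow_prime_eq`** — `‖m‖ < 1 ⇒ ‖Tr_{K/ℚ_p}(m)‖ ≤ p⁻²` (transitivity of the trace); hence,
  by the local criterion `div_le_differentOrd_iff_trace` (Serre III §3 Prop. 7 / §4 Prop. 10),
  **`sub_one_div_le_differentOrd_of_pow_prime_eq`: `(2e − 1)/e ≤ d_K`** and
  `maximalIdeal_pow_dvd_different_of_pow_prime_eq`: `𝔪_K^{2e−1} ∣ 𝔇_K` — the maximal value allowed by Ore's
  bound when `v_p(e) = 1`.

Consumer (abc-iut R-W GAP G-Wnum2-1 / D-G-Wnum2-1, inhabited side of the window table at the wild packets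
`p ∈ {3, 5}`): at a place of the genuine tower over a pole of `j` of order `2t` with `p ∤ t`, the Tate
parameter `q ∈ ℚ_p` (`v_p(q) = 2t`) has a `p`-th root in the completion, so `y := ρ^α/p^β` with
`α·2t = β·p + 1` is such a radical and `v(𝔇) ≥ 2e − 1 ≥ (e/p)(2p − 1)`.
PROOF-ONLY file (theorems, no definitions, no named `Prop` facts); nothing here is disputed mathematics.
[cite: SerreLocalFields1979, Ch. III §6 Prop. 13] [cite: NeukirchANT1999, Ch. II Thm. (4.8)]
-/

noncomputable section

open Metric Set IsLocalRing Module Polynomial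
open scoped NormedField IntermediateField

namespace Literature.IUT.LogVolume

/-! ## §1 The ultrametric «distinct norms» principle -/

section DistinctNorms

variable {K : Type*} [NormedField K] [IsUltrametricDist K]

/-- **Distinct norms**: if the nonzero terms of a finite sum in an ultrametric normed field have pairwise
distinct norms, then the sum is zero or its norm is the norm of one of its nonzero terms, and every term is
bounded in norm by the sum. [cite: NeukirchANT1999, Ch. II Thm. (4.8)] -/
theorem norm_le_norm_sum_and_exists_of_pairwise_norm_ne {ι : Type*} [DecidableEq ι] (s : Finset ι) (f : ι → K)
    (h : ∀ i ∈ s, ∀ j ∈ s, i ≠ j → f i ≠ 0 → f j ≠ 0 → ‖f i‖ ≠ ‖f j‖) :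
    (∀ i ∈ s, ‖f i‖ ≤ ‖∑ j ∈ s, f j‖) ∧
      (∑ j ∈ s, f j = 0 ∨ ∃ i ∈ s, f i ≠ 0 ∧ ‖∑ j ∈ s, f j‖ = ‖f i‖) := by
  induction s using Finset.induction_on with
  | empty => simp
  | insert a s ha ih =>
    have h' : ∀ i ∈ s, ∀ j ∈ s, i ≠ j → f i ≠ 0 → f j ≠ 0 → ‖f i‖ ≠ ‖f j‖ := fun i hi j hj =>
      h i (Finset.mem_insert_of_mem hi) j (Finset.mem_insert_of_mem hj)
    obtain ⟨ih₁, ih₂⟩ := ih h'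
    rw [Finset.sum_insert ha]
    by_cases hfa : f a = 0
    · rw [hfa, zero_add]
      refine ⟨fun i hi => ?_, ?_⟩
      · rcases Finset.mem_insert.mp hi with rfl | hi
        · rw [hfa, norm_zero]; exact norm_nonneg _
        · exact ih₁ i hi
      · rcases ih₂ with h0 | ⟨i, hi, hfi, hn⟩
        · exact Or.inl h0
        · exact Or.inr ⟨i, Finset.mem_insert_of_mem hi, hfi, hn⟩
    rcases ih₂ with h0 | ⟨i₀, hi₀, hfi₀, hn₀⟩
    · -- the tail vanishes
      rw [h0, add_zero]
      refine ⟨fun i hi => ?_, Or.inr ⟨a, Finset.mem_insert_self a s, hfa, rfl⟩⟩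
      rcases Finset.mem_insert.mp hi with rfl | hi
      · exact le_rfl
      · have := ih₁ i hi
        rw [h0, norm_zero] at this
        exact this.trans (norm_nonneg _)
    · -- the tail has the norm of its term `i₀ ≠ a`, distinct from `‖f a‖`
      have hne : ‖f a‖ ≠ ‖∑ j ∈ s, f j‖ := by
        rw [hn₀]
        exact h a (Finset.mem_insert_self a s) i₀ (Finset.mem_insert_of_mem hi₀)
          (fun hai => ha (hai ▸ hi₀)) hfa hfi₀
      have hmax := IsUltrametricDist.norm_add_eq_max_of_norm_ne_norm hne
      refine ⟨fun i hi => ?_, ?_⟩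
      · rw [hmax]
        rcases Finset.mem_insert.mp hi with rfl | hi
        · exact le_max_left _ _
        · exact (ih₁ i hi).trans (le_max_right _ _)
      · right
        rcases le_total ‖f a‖ ‖∑ j ∈ s, f j‖ with hle | hle
        · exact ⟨i₀, Finset.mem_insert_of_mem hi₀, hfi₀, by rw [hmax, max_eq_right hle, hn₀]⟩
        · exact ⟨a, Finset.mem_insert_self a s, hfa, by rw [hmax, max_eq_left hle]⟩

/-- **Every term is bounded by the sum** when the nonzero terms have pairwise distinct norms (ultrametric).
[cite: NeukirchANT1999, Ch. II Thm. (4.8)] -/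
theorem norm_le_norm_sum_of_pairwise_norm_ne {ι : Type*} [DecidableEq ι] (s : Finset ι) (f : ι → K)
    (h : ∀ i ∈ s, ∀ j ∈ s, i ≠ j → f i ≠ 0 → f j ≠ 0 → ‖f i‖ ≠ ‖f j‖) {i : ι} (hi : i ∈ s) :
    ‖f i‖ ≤ ‖∑ j ∈ s, f j‖ :=
  (norm_le_norm_sum_and_exists_of_pairwise_norm_ne s f h).1 i hi

end DistinctNorms

/-! ## §2 An Eisenstein radical `y`, `y^p = π`, `‖π‖ = p⁻¹` -/

section Radical

variable (p : ℕ) [Fact p.Prime]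
variable {K : Type} [NontriviallyNormedField K] [NormedAlgebra ℚ_[p] K] [IsUltrametricDist K] [ProperSpace K]
variable {π : ℚ_[p]} (hπ : ‖π‖ = (p : ℝ)⁻¹) {y : K} (hy : y ^ p = algebraMap ℚ_[p] K π)

include hπ hy

omit [IsUltrametricDist K] [ProperSpace K] in
/-- `‖y‖ = p^{−1/p}` for `y^p = π`, `‖π‖ = p⁻¹`. [cite: SerreLocalFields1979, Ch. III §6 Prop. 13] -/
theorem norm_eq_rpow_of_pow_prime_eq : ‖y‖ = (p : ℝ) ^ (-(1 / (p : ℝ))) := by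
  have hp0 : (0 : ℝ) < p := by exact_mod_cast (Fact.out : p.Prime).pos
  have hpne : (p : ℝ) ≠ 0 := hp0.ne'
  have h1 : ‖y‖ ^ p = (p : ℝ)⁻¹ := by rw [← norm_pow, hy, norm_algebraMap', hπ]
  have hpn : (p : ℕ) ≠ 0 := (Fact.out : p.Prime).ne_zero
  calc ‖y‖ = (‖y‖ ^ p) ^ ((p : ℝ)⁻¹) := (Real.pow_rpow_inv_natCast (norm_nonneg _) hpn).symm
    _ = ((p : ℝ) ^ (-1 : ℝ)) ^ ((p : ℝ)⁻¹) := by rw [h1, Real.rpow_neg_one]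
    _ = (p : ℝ) ^ (-(1 / (p : ℝ))) := by
        rw [← Real.rpow_mul hp0.le]
        congr 1
        field_simp

omit [IsUltrametricDist K] [ProperSpace K] in
/-- `y ≠ 0`. [cite: SerreLocalFields1979, Ch. III §6 Prop. 13] -/
theorem ne_zero_of_pow_prime_eq : y ≠ 0 := by
  intro h0
  have h := norm_eq_rpow_of_pow_prime_eq p hπ hy
  rw [h0, norm_zero] at h
  have hp0 : (0 : ℝ) < p := by exact_mod_cast (Fact.out : p.Prime).pos
  exact (Real.rpow_pos_of_pos hp0 _).ne h

/-- **`p ∣ e`**: the value group `p^{(1/e)ℤ}` of `K` contains `‖y‖ = p^{−1/p}`, so `1/p ∈ (1/e)ℤ`.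
[cite: SerreLocalFields1979, Ch. III §6 Prop. 13] -/
theorem prime_dvd_absRamificationIdx_of_pow_prime_eq : p ∣ absRamificationIdx p K := by
  obtain ⟨m, hm⟩ := exists_norm_eq_rpow p K (ne_zero_of_pow_prime_eq p hπ hy)
  rw [norm_eq_rpow_of_pow_prime_eq p hπ hy] at hm
  have hp1 : (1 : ℝ) < p := by exact_mod_cast (Fact.out : p.Prime).one_lt
  have hp0 : (0 : ℝ) < p := by positivity
  have he0 : (0 : ℝ) < absRamificationIdx p K := by exact_mod_cast absRamificationIdx_pos p K
  have hexp : (1 / (p : ℝ)) = (m : ℝ) / (absRamificationIdx p K : ℝ) := by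
    have h := congrArg (Real.logb p) hm
    rw [Real.logb_rpow hp0 hp1.ne', Real.logb_rpow hp0 hp1.ne'] at h
    linarith
  have hmul : (absRamificationIdx p K : ℝ) = (m : ℝ) * p := by
    field_simp at hexp
    linarith
  have hint : (absRamificationIdx p K : ℤ) = m * p := by exact_mod_cast hmul
  have hdvd : (p : ℤ) ∣ (absRamificationIdx p K : ℤ) := ⟨m, by rw [hint, mul_comm]⟩
  exact_mod_cast hdvd

omit [IsUltrametricDist K] [ProperSpace K] in
/-- **Pairwise distinct norms of the monomials `a·y^i`, `i < p`** (`a ∈ ℚ_p^×`): `‖a y^i‖ = p^{−v(a) − i/p}` and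
`i/p ≢ j/p (mod ℤ)` for `i ≠ j` below `p`. [cite: SerreLocalFields1979, Ch. III §6 Prop. 13] -/
theorem norm_smul_pow_ne_of_pow_prime_eq {i j : ℕ} (hi : i < p) (hj : j < p) (hij : i ≠ j) {a b : ℚ_[p]}
    (ha : a ≠ 0) (hb : b ≠ 0) : ‖a • y ^ i‖ ≠ ‖b • y ^ j‖ := by
  have hp1 : (1 : ℝ) < p := by exact_mod_cast (Fact.out : p.Prime).one_lt
  have hp0 : (0 : ℝ) < p := by positivity
  have hyn := norm_eq_rpow_of_pow_prime_eq p hπ hy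
  -- `‖c • y^k‖ = p^{-(v c) - k/p}`
  have key : ∀ (c : ℚ_[p]) (k : ℕ), c ≠ 0 →
      ‖c • y ^ k‖ = (p : ℝ) ^ (-(c.valuation : ℝ) - (k : ℝ) / p) := by
    intro c k hc
    rw [norm_smul, norm_pow, hyn, Padic.norm_eq_zpow_neg_valuation hc, ← Real.rpow_intCast,
      ← Real.rpow_natCast ((p : ℝ) ^ (-(1 / (p : ℝ)))) k, ← Real.rpow_mul hp0.le, ← Real.rpow_add hp0]
    congr 1
    push_cast
    ring
  intro heq
  rw [key a i ha, key b j hb] at heq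
  have hlog := congrArg (Real.logb p) heq
  rw [Real.logb_rpow hp0 hp1.ne', Real.logb_rpow hp0 hp1.ne'] at hlog
  -- `(j - i) = p * (va - vb)` in `ℤ`
  have hreal : ((j : ℤ) - i : ℝ) = (p : ℝ) * ((a.valuation - b.valuation : ℤ) : ℝ) := by
    push_cast
    field_simp at hlog
    linarith
  have hint : ((j : ℤ) - i) = (p : ℤ) * (a.valuation - b.valuation) := by exact_mod_cast hreal
  have hdvd : (p : ℤ) ∣ ((j : ℤ) - i) := ⟨_, hint⟩
  have hlt : ((j : ℤ) - i).natAbs < (p : ℤ).natAbs := by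
    rw [Int.natAbs_natCast]
    omega
  have h0 := Int.eq_zero_of_dvd_of_natAbs_lt_natAbs hdvd hlt
  omega

omit [ProperSpace K] in
/-- **`‖a_k y^k‖ ≤ ‖Σ_{j<p} a_j y^j‖`** for coefficients `a_j ∈ ℚ_p` (distinct norms principle).
[cite: SerreLocalFields1979, Ch. III §6 Prop. 13] -/
theorem norm_smul_pow_le_norm_sum_of_pow_prime_eq (a : Fin p → ℚ_[p]) (k : Fin p) :
    ‖a k • y ^ (k : ℕ)‖ ≤ ‖∑ j : Fin p, a j • y ^ (j : ℕ)‖ := by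
  classical
  refine norm_le_norm_sum_of_pairwise_norm_ne (Finset.univ : Finset (Fin p)) (fun j => a j • y ^ (j : ℕ))
    (fun i _ j _ hij hi hj => ?_) (Finset.mem_univ k)
  have hy0 := ne_zero_of_pow_prime_eq p hπ hy
  have hai : a i ≠ 0 := by
    intro h; exact hi (by simp only [h, zero_smul])
  have haj : a j ≠ 0 := by
    intro h; exact hj (by simp only [h, zero_smul])
  exact norm_smul_pow_ne_of_pow_prime_eq p hπ hy i.isLt j.isLt (fun h => hij (Fin.ext h)) hai haj

end Radical

/-! ## §3 The trace does not increase the norm along an intermediate field -/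

section TraceIntermediate

variable (p : ℕ) [Fact p.Prime]
variable {K : Type} [NontriviallyNormedField K] [NormedAlgebra ℚ_[p] K] [IsUltrametricDist K] [ProperSpace K]

/-- **`‖Tr_{K/V}(m)‖ ≤ ‖m‖`** for an intermediate field `ℚ_p ⊆ V ⊆ K` of a `p`-adic field: the trace is the sum of
the `V`-conjugates of `m` in `ℚ̄_p`, each an isometric image (uniqueness of the extension of `|·|_p`, the tree's
`norm_map_algHom`), and `ℚ̄_p` is ultrametric. [cite: NeukirchANT1999, Ch. II Thm. (4.8)] -/
theorem norm_trace_intermediateField_le (V : IntermediateField ℚ_[p] K) (m : K) :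
    ‖Algebra.trace V K m‖ ≤ ‖m‖ := by
  haveI : FiniteDimensional ℚ_[p] K := FiniteDimensional.of_locallyCompactSpace ℚ_[p]
  haveI : FiniteDimensional V K := inferInstance
  haveI : CharZero V := charZero_of_injective_algebraMap (algebraMap ℚ_[p] V).injective
  haveI : Algebra.IsSeparable V K := Algebra.IsSeparable.of_integral V K
  haveI : ProperSpace V := FiniteDimensional.proper ℚ_[p] V
  haveI : Algebra.IsAlgebraic ℚ_[p] V := Algebra.IsAlgebraic.of_finite ℚ_[p] V
  let τ₀ : V →ₐ[ℚ_[p]] PadicAlgCl p := IsAlgClosed.lift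
  letI : Algebra V (PadicAlgCl p) := τ₀.toRingHom.toAlgebra
  haveI : IsScalarTower ℚ_[p] V (PadicAlgCl p) :=
    IsScalarTower.of_algebraMap_eq fun x => (τ₀.commutes x).symm
  have h := trace_eq_sum_embeddings (PadicAlgCl p) (K := V) (L := K) (x := m)
  have hτ₀ : ‖algebraMap V (PadicAlgCl p) (Algebra.trace V K m)‖ = ‖Algebra.trace V K m‖ :=
    norm_map_algHom τ₀ _
  rw [← hτ₀, h]
  refine IsUltrametricDist.norm_sum_le_of_forall_le_of_nonneg (norm_nonneg m) fun τ _ => ?_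
  exact (norm_map_algHom (τ.restrictScalars ℚ_[p]) m).le

end TraceIntermediate

/-! ## §4 The trace on `V = ℚ_p(y)` and on `K` -/

section Trace

variable (p : ℕ) [Fact p.Prime]
variable {K : Type} [NontriviallyNormedField K] [NormedAlgebra ℚ_[p] K] [IsUltrametricDist K] [ProperSpace K]
variable {π : ℚ_[p]} (hπ : ‖π‖ = (p : ℝ)⁻¹) {y : K} (hy : y ^ p = algebraMap ℚ_[p] K π)

include hπ hy

/-- **`‖m‖ < 1 ⇒ ‖Tr_{V/ℚ_p}(m)‖ ≤ p⁻²` on `V = ℚ_p(y)`**: in the basis `1, y, …, y^{p−1}` of `V` the matrix of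
multiplication by `y^k` (`0 < k < p`) has zero diagonal (`y^k·y^j ∈ ℚ_p·y^{(j+k) mod p}`, `(j+k) mod p ≠ j`),
so `Tr(Σ a_k y^k) = p·a₀`, and `‖a₀‖ ≤ ‖Σ a_k y^k‖ < 1` forces `‖a₀‖ ≤ p⁻¹` (the value group of `ℚ_p` is `p^ℤ`).
[cite: SerreLocalFields1979, Ch. III §6 Prop. 13] -/
theorem norm_trace_adjoin_le_of_pow_prime_eq (m : ℚ_[p]⟮y⟯) (hm : ‖m‖ < 1) :
    ‖Algebra.trace ℚ_[p] ℚ_[p]⟮y⟯ m‖ ≤ (p : ℝ)⁻¹ * (p : ℝ)⁻¹ := by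
  classical
  have hpp : p.Prime := Fact.out
  have hp0n : 0 < p := hpp.pos
  have hyV : y ∈ ℚ_[p]⟮y⟯ := IntermediateField.mem_adjoin_simple_self ℚ_[p] y
  have hyVp : (⟨y, hyV⟩ : ℚ_[p]⟮y⟯) ^ p = algebraMap ℚ_[p] ℚ_[p]⟮y⟯ π := by
    apply Subtype.ext
    show ((⟨y, hyV⟩ ^ p : ℚ_[p]⟮y⟯) : K) = ((algebraMap ℚ_[p] ℚ_[p]⟮y⟯ π : ℚ_[p]⟮y⟯) : K)
    rw [SubmonoidClass.coe_pow]
    exact hy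
  -- the basis `v k = y^k`, `k < p`
  set v : Fin p → ℚ_[p]⟮y⟯ := fun k => (⟨y, hyV⟩ : ℚ_[p]⟮y⟯) ^ (k : ℕ) with hvdef
  have hcoev : ∀ k : Fin p, ((v k : ℚ_[p]⟮y⟯) : K) = y ^ (k : ℕ) := fun k => by
    simp only [hvdef, SubmonoidClass.coe_pow]
  have hcoesum : ∀ c : Fin p → ℚ_[p], ((∑ k, c k • v k : ℚ_[p]⟮y⟯) : K) = ∑ k, c k • y ^ (k : ℕ) := by
    intro c
    rw [← IntermediateField.coe_val, map_sum]
    refine Finset.sum_congr rfl fun k _ => ?_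
    rw [map_smul, IntermediateField.coe_val, hcoev]
  have hli : LinearIndependent ℚ_[p] v := by
    rw [Fintype.linearIndependent_iff]
    intro c hc k
    have hsum0 : ∑ j, c j • y ^ (j : ℕ) = 0 := by
      rw [← hcoesum, hc]; rfl
    have hle := norm_smul_pow_le_norm_sum_of_pow_prime_eq p hπ hy c k
    rw [hsum0, norm_zero] at hle
    have h0 : c k • y ^ (k : ℕ) = 0 := norm_eq_zero.mp (le_antisymm hle (norm_nonneg _))
    rcases smul_eq_zero.mp h0 with h | h
    · exact h
    · exact absurd h (pow_ne_zero _ (ne_zero_of_pow_prime_eq p hπ hy))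
  -- spanning: every element of `ℚ_p(y)` is a polynomial in `y` of degree `< p`
  have hspan : ∀ x : ℚ_[p]⟮y⟯, ∃ c : Fin p → ℚ_[p], x = ∑ k, c k • v k := by
    intro x
    haveI : FiniteDimensional ℚ_[p] K := FiniteDimensional.of_locallyCompactSpace ℚ_[p]
    have halg : IsAlgebraic ℚ_[p] y := Algebra.IsAlgebraic.isAlgebraic y
    have hxS : (x : K) ∈ (IntermediateField.adjoin ℚ_[p] {y}).toSubalgebra := x.2
    rw [IntermediateField.adjoin_simple_toSubalgebra_of_isAlgebraic halg,
      Algebra.adjoin_singleton_eq_range_aeval] at hxS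
    obtain ⟨f, hf⟩ := hxS
    set g : ℚ_[p][X] := X ^ p - C π with hgdef
    have hgm : g.Monic := monic_X_pow_sub_C π hpp.ne_zero
    have hg1 : g ≠ 1 := by
      intro h
      have := congrArg natDegree h
      rw [hgdef, natDegree_X_pow_sub_C, natDegree_one] at this
      exact hpp.ne_zero this
    have hroot : aeval y g = 0 := by
      rw [hgdef, map_sub, map_pow, aeval_X, aeval_C, hy, sub_self]
    have hdeg : (f %ₘ g).natDegree < p := by
      have := natDegree_modByMonic_lt f hgm hg1
      rwa [hgdef, natDegree_X_pow_sub_C] at this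
    have hx : (x : K) = ∑ i ∈ Finset.range p, (f %ₘ g).coeff i • y ^ i := by
      rw [← hf]
      change aeval y f = _
      rw [← aeval_modByMonic_eq_self_of_root (p := f) hroot, aeval_eq_sum_range' hdeg]
    refine ⟨fun k => (f %ₘ g).coeff k, Subtype.ext ?_⟩
    rw [hcoesum, hx, ← Fin.sum_univ_eq_sum_range]
  have hsp : ⊤ ≤ Submodule.span ℚ_[p] (Set.range v) := by
    intro x _
    obtain ⟨c, hc⟩ := hspan x
    rw [hc]
    exact Submodule.sum_mem _ fun k _ => Submodule.smul_mem _ _ (Submodule.subset_span ⟨k, rfl⟩)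
  let b : Basis (Fin p) ℚ_[p] ℚ_[p]⟮y⟯ := Basis.mk hli hsp
  have hb : ∀ k, b k = v k := fun k => Basis.mk_apply hli hsp k
  -- traces of the basis vectors: `Tr(1) = p`, `Tr(y^k) = 0` for `0 < k < p`
  have hrank : Module.finrank ℚ_[p] ℚ_[p]⟮y⟯ = p :=
    (Module.finrank_eq_card_basis b).trans (Fintype.card_fin p)
  have htr0 : Algebra.trace ℚ_[p] ℚ_[p]⟮y⟯ (v ⟨0, hp0n⟩) = (p : ℚ_[p]) := by
    have h := Algebra.trace_algebraMap (R := ℚ_[p]) (S := ℚ_[p]⟮y⟯) (1 : ℚ_[p])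
    rw [map_one, hrank, nsmul_eq_mul, mul_one] at h
    have h1 : v ⟨0, hp0n⟩ = 1 := by simp only [hvdef, pow_zero]
    rw [h1]
    exact h
  have htrk : ∀ k : Fin p, (k : ℕ) ≠ 0 → Algebra.trace ℚ_[p] ℚ_[p]⟮y⟯ (v k) = 0 := by
    intro k hk
    refine (Algebra.trace_eq_matrix_trace b (v k)).trans ?_
    rw [Matrix.trace]
    refine Finset.sum_eq_zero fun j _ => ?_
    rw [Matrix.diag_apply, Algebra.leftMulMatrix_eq_repr_mul, hb]
    by_cases hkj : (k : ℕ) + j < p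
    · have hprod : v k * v j = b ⟨(k : ℕ) + j, hkj⟩ := by
        rw [hb]; simp only [hvdef, ← pow_add]
      rw [hprod, b.repr_self, Finsupp.single_apply, if_neg]
      intro h
      have := congrArg Fin.val h
      simp only at this
      omega
    · push Not at hkj
      have hlt : (k : ℕ) + j - p < p := by omega
      have hprod : v k * v j = π • b ⟨(k : ℕ) + j - p, hlt⟩ := by
        rw [hb]
        simp only [hvdef]
        rw [← pow_add, show (k : ℕ) + (j : ℕ) = p + ((k : ℕ) + j - p) by omega, pow_add, hyVp,
          Algebra.smul_def, Nat.add_sub_cancel_left]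
        rfl
      rw [hprod, map_smul, b.repr_self, Finsupp.smul_apply, Finsupp.single_apply, if_neg, smul_zero]
      intro h
      have := congrArg Fin.val h
      simp only at this
      omega
  -- expand `m` in the basis
  obtain ⟨c, hc⟩ := hspan m
  have htr : Algebra.trace ℚ_[p] ℚ_[p]⟮y⟯ m = c ⟨0, hp0n⟩ * p := by
    rw [hc, map_sum]
    simp only [map_smul, smul_eq_mul]
    rw [Finset.sum_eq_single ⟨0, hp0n⟩]
    · rw [htr0]
    · intro k _ hk
      rw [htrk k (fun h => hk (Fin.ext h)), mul_zero]
    · intro h; exact absurd (Finset.mem_univ _) h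
  -- `‖c 0‖ ≤ ‖m‖ < 1`, hence `‖c 0‖ ≤ p⁻¹`
  have hc0 : ‖c ⟨0, hp0n⟩‖ ≤ (p : ℝ)⁻¹ := by
    have hle := norm_smul_pow_le_norm_sum_of_pow_prime_eq p hπ hy c ⟨0, hp0n⟩
    simp only [pow_zero] at hle
    rw [norm_smul, norm_one, mul_one, ← hcoesum, ← hc] at hle
    have hlt : ‖c ⟨0, hp0n⟩‖ < 1 := lt_of_le_of_lt hle hm
    -- discreteness of `|·|_p` (the tree's `Literature.NumberTheory.EllipticCurves.norm_le_inv_of_norm_lt_one`, inlined)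
    have h := (Padic.norm_le_pow_iff_norm_lt_pow_add_one (c ⟨0, hp0n⟩) (-1)).mpr (by simpa using hlt)
    simpa using h
  rw [htr, norm_mul]
  have hpK : ‖(p : ℚ_[p])‖ = (p : ℝ)⁻¹ := Padic.norm_p
  rw [hpK]
  exact mul_le_mul_of_nonneg_right hc0 (by positivity)

/-- **`‖m‖ < 1 ⇒ ‖Tr_{K/ℚ_p}(m)‖ ≤ p⁻²`** for a `p`-adic field `K` containing `y` with `y^p = π`, `‖π‖ = p⁻¹`:
`Tr_{K/ℚ_p} = Tr_{V/ℚ_p} ∘ Tr_{K/V}` with `V = ℚ_p(y)`, `Tr_{K/V}(𝔪_K) ⊆ 𝔪_V`, and `Tr_{V/ℚ_p}(𝔪_V) ⊆ p²ℤ_p`.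
Equivalently `Tr_{K/ℚ_p}(𝔪_K) ⊆ p·π·ℤ_p`, i.e. `(pπ)⁻¹𝔪_K = 𝔪_K^{−(2e−1)} ⊆ 𝔇_K⁻¹`.
[cite: SerreLocalFields1979, Ch. III §6 Prop. 13] -/
theorem norm_trace_le_of_pow_prime_eq (m : K) (hm : ‖m‖ < 1) :
    ‖Algebra.trace ℚ_[p] K m‖ ≤ (p : ℝ)⁻¹ * (p : ℝ)⁻¹ := by
  haveI : FiniteDimensional ℚ_[p] K := FiniteDimensional.of_locallyCompactSpace ℚ_[p]
  haveI : FiniteDimensional ℚ_[p]⟮y⟯ K := inferInstance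
  haveI : FiniteDimensional ℚ_[p] ℚ_[p]⟮y⟯ := inferInstance
  have htt : Algebra.trace ℚ_[p] K m = Algebra.trace ℚ_[p] ℚ_[p]⟮y⟯ (Algebra.trace ℚ_[p]⟮y⟯ K m) :=
    (Algebra.trace_trace (R := ℚ_[p]) (S := ℚ_[p]⟮y⟯) (T := K) m).symm
  rw [htt]
  refine norm_trace_adjoin_le_of_pow_prime_eq p hπ hy _ ?_
  exact lt_of_le_of_lt (norm_trace_intermediateField_le p ℚ_[p]⟮y⟯ m) hm

/-- **`(2e − 1)/e ≤ d_K`**: the different of a `p`-adic field containing a `p`-th root of a uniformizer of `ℚ_p`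
has order at least `2e − 1` (`= e − 1 + v_K(e)` when `v_p(e) = 1`: Ore's bound is attained), via the local
criterion `𝔪^n ∣ 𝔇 ⟺ Tr(𝔪^{−n}𝒪_K) ⊆ ℤ_p` (Serre III §3 Prop. 7) with `n = 2e − 1`: for `z ∈ 𝔪^{−(2e−1)}`,
`w ∈ 𝒪_K`, `p·π·z·w ∈ 𝔪_K`, so `‖Tr(z w)‖ = p²·‖Tr(pπ z w)‖ ≤ 1`. [cite: SerreLocalFields1979, Ch. III §6 Prop. 13] -/
theorem sub_one_div_le_differentOrd_of_pow_prime_eq :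
    ((2 * absRamificationIdx p K - 1 : ℕ) : ℝ) / (absRamificationIdx p K : ℝ) ≤ differentOrd p K := by
  rw [div_le_differentOrd_iff_trace]
  intro z hz w hw
  have hpp : p.Prime := Fact.out
  have hp0 : (0 : ℝ) < p := by exact_mod_cast hpp.pos
  have hp1 : (1 : ℝ) < p := by exact_mod_cast hpp.one_lt
  have he := absRamificationIdx_pos p K
  -- a uniformizer `ϖ₀` of `𝒪_K`: `‖ϖ₀‖ < 1`, `‖p‖ = ‖ϖ₀‖^e`
  obtain ⟨ϖ₀, hϖ₀⟩ := IsDiscreteValuationRing.exists_irreducible (Valued.integer K)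
  have hϖn : ‖(ϖ₀ : K)‖ = (p : ℝ) ^ (-(1 / (absRamificationIdx p K : ℝ))) := norm_irreducible_eq p K hϖ₀
  have hϖlt : ‖(ϖ₀ : K)‖ < 1 := by
    rw [hϖn]
    exact Real.rpow_lt_one_of_one_lt_of_neg hp1 (by
      have : (0 : ℝ) < 1 / (absRamificationIdx p K : ℝ) := by positivity
      linarith)
  have hϖpos : 0 < ‖(ϖ₀ : K)‖ := by rw [hϖn]; exact Real.rpow_pos_of_pos hp0 _
  have hpϖ : ‖(p : K)‖ = ‖(ϖ₀ : K)‖ ^ absRamificationIdx p K := norm_prime_eq_norm_irreducible_pow p K hϖ₀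
  -- `‖ϖ₀^{2e-1} · z‖ ≤ 1`
  have hmem : (ϖ₀ ^ (2 * absRamificationIdx p K - 1) : Valued.integer K) ∈
      maximalIdeal (Valued.integer K) ^ (2 * absRamificationIdx p K - 1) :=
    Ideal.pow_mem_pow ((IsLocalRing.mem_maximalIdeal _).mpr hϖ₀.not_isUnit) _
  have hz' := hz _ hmem
  rw [SubmonoidClass.coe_pow, norm_mul, norm_pow] at hz'
  -- the element `m = p·π·z·w ∈ 𝔪_K`
  have hπ0 : π ≠ 0 := by
    intro h; rw [h, norm_zero] at hπ; exact (inv_pos.mpr hp0).ne' hπ.symm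
  set c : ℚ_[p] := (p : ℚ_[p]) * π with hcdef
  have hc0 : c ≠ 0 := mul_ne_zero (Nat.cast_ne_zero.mpr hpp.ne_zero) hπ0
  have hcn : ‖c‖ = (p : ℝ)⁻¹ * (p : ℝ)⁻¹ := by rw [hcdef, norm_mul, Padic.norm_p, hπ]
  have hcK : ‖algebraMap ℚ_[p] K c‖ = ‖(ϖ₀ : K)‖ ^ (2 * absRamificationIdx p K) := by
    rw [norm_algebraMap', hcn, mul_comm 2 _, pow_mul, ← hpϖ, norm_prime p K, pow_two]
  set m : K := c • (z * w) with hmdef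
  have hm : ‖m‖ < 1 := by
    rw [hmdef, norm_smul, ← norm_algebraMap' K c, hcK, norm_mul]
    have hsplit : ‖(ϖ₀ : K)‖ ^ (2 * absRamificationIdx p K) =
        ‖(ϖ₀ : K)‖ * ‖(ϖ₀ : K)‖ ^ (2 * absRamificationIdx p K - 1) := by
      rw [← pow_succ']
      congr 1
      omega
    rw [hsplit]
    calc ‖(ϖ₀ : K)‖ * ‖(ϖ₀ : K)‖ ^ (2 * absRamificationIdx p K - 1) * (‖z‖ * ‖w‖)
        = ‖(ϖ₀ : K)‖ * ((‖(ϖ₀ : K)‖ ^ (2 * absRamificationIdx p K - 1) * ‖z‖) * ‖w‖) := by ring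
      _ ≤ ‖(ϖ₀ : K)‖ * (1 * 1) := by gcongr
      _ < 1 := by rw [mul_one, mul_one]; exact hϖlt
  have htr := norm_trace_le_of_pow_prime_eq p hπ hy m hm
  have hlin : Algebra.trace ℚ_[p] K m = c • Algebra.trace ℚ_[p] K (z * w) := by
    rw [hmdef, map_smul]
  rw [hlin, norm_smul, hcn] at htr
  have hpos : (0 : ℝ) < (p : ℝ)⁻¹ * (p : ℝ)⁻¹ := by positivity
  calc ‖Algebra.trace ℚ_[p] K (z * w)‖
      = ((p : ℝ)⁻¹ * (p : ℝ)⁻¹ * ‖Algebra.trace ℚ_[p] K (z * w)‖) / ((p : ℝ)⁻¹ * (p : ℝ)⁻¹) := by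
        field_simp
    _ ≤ ((p : ℝ)⁻¹ * (p : ℝ)⁻¹) / ((p : ℝ)⁻¹ * (p : ℝ)⁻¹) := by gcongr
    _ = 1 := div_self hpos.ne'

/-- **`𝔪_K^{2e−1} ∣ 𝔇_{𝒪_K/ℤ_p}`** (ideal form of `sub_one_div_le_differentOrd_of_pow_prime_eq`).
[cite: SerreLocalFields1979, Ch. III §6 Prop. 13] -/
theorem maximalIdeal_pow_dvd_different_of_pow_prime_eq :
    maximalIdeal (Valued.integer K) ^ (2 * absRamificationIdx p K - 1) ∣ different p K :=
  (div_le_differentOrd_iff_pow_dvd p K _).mp (sub_one_div_le_differentOrd_of_pow_prime_eq p hπ hy)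

/-- **Consumer form: `(e/p)·(2p − 1) ≤ e·d_K`** — the lower bound of abc-iut D-G-Wnum2-1 (ii) at a W1 packet, as the
weaker consequence of `2e − 1 ≤ e·d_K` (`(e/p)(2p−1) = 2e − e/p ≤ 2e − 1` since `p ∣ e`, `e ≥ p`).
[cite: SerreLocalFields1979, Ch. III §6 Prop. 13] -/
theorem div_mul_le_mul_differentOrd_of_pow_prime_eq :
    ((absRamificationIdx p K / p * (2 * p - 1) : ℕ) : ℝ) ≤ (absRamificationIdx p K : ℝ) * differentOrd p K := by
  have he := absRamificationIdx_pos p K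
  have he0 : (0 : ℝ) < absRamificationIdx p K := by exact_mod_cast he
  have hmain := sub_one_div_le_differentOrd_of_pow_prime_eq p hπ hy
  rw [div_le_iff₀ he0] at hmain
  have hdvd := prime_dvd_absRamificationIdx_of_pow_prime_eq p hπ hy
  have hpp : p.Prime := Fact.out
  obtain ⟨k, hk⟩ := hdvd
  have hk1 : 1 ≤ k := by
    rcases Nat.eq_zero_or_pos k with h | h
    · rw [h, mul_zero] at hk; omega
    · exact h
  have hnat : absRamificationIdx p K / p * (2 * p - 1) ≤ 2 * absRamificationIdx p K - 1 := by
    rw [hk, Nat.mul_div_cancel_left k hpp.pos]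
    have h2 : k * (2 * p - 1) = 2 * (p * k) - k := by
      rw [Nat.mul_sub, mul_one]
      ring_nf
    rw [h2]
    omega
  calc ((absRamificationIdx p K / p * (2 * p - 1) : ℕ) : ℝ)
      ≤ ((2 * absRamificationIdx p K - 1 : ℕ) : ℝ) := by exact_mod_cast hnat
    _ ≤ differentOrd p K * (absRamificationIdx p K : ℝ) := hmain
    _ = (absRamificationIdx p K : ℝ) * differentOrd p K := mul_comm _ _

end Trace

end Literature.IUT.LogVolume

end
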